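import Summits.QuantumFields.BalabanUV.T4Continuum.Support.NE9CurChartTowerPiLatticeUniformClassW80VJDelta
import Summits.QuantumFields.BalabanUV.T4Continuum.Support.NE9CurChartTowerPiLatticeUniformFlatWitness

/-!
# NE9CurChartTowerPiLatticeUniformClassW80VJDeltaTopLevel — THE k-LEVEL `cur U` CHART OF PRINT's OPERATOR (3.122) WITH THE CONCRETE (L3) CURRENT AND THE
# CONCRETE `Δ_π`, AT THE TOP-LEVEL (115) PROFILE `lev₀ = lev₁ ≡ n+1`: EVERY DISPLAYED LETTER GONE — for every height `n`, spacing `η` on the diagonal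
# `L^{n+1}η = 1`, period `m`, and every background `U` of print's small-field class (unitary values of a C⋆-algebra; `‖U(b) − 1‖ ≤ αη`, plaquettes and
# same-direction gradients `≤ αη²`, `α ≤ α₁`; current window `j₀ ≤ j₁`), the chart `Φ_U` of `cur U` satisfies (Ψ1)–(Ψ3) on ONE ball `R_b`, into ONE ball `R′`,
# with `(α₁, j₁, ε₄, ε_C, R_b, R′)` chosen BEFORE the lattice and NOTHING ELSE ASSUMED; cell `pub-balaban`, T4-DAG §2 node U3 ∕ §6 NE9, WALL-NE9-P1 §3 (ii)∕(vii);
# NE9 crux-team (2) leaf prover 01 (`b2b-balaban-t4-ne9-formalise-leaf-01`, gen 98); sibling of (S3) `…ClassW80VJDelta` and of (I-9)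
# `…FlatWitness` (whose `topLevel_weights` ∕ `zeroExp_weights` discharge the profile letters `ω = Ω = 1`); INTERFACE REQUEST NE9 [NE9LEAF01-G98-IFR];
# nothing printed asserted

HONEST FRAMING (T4-DAG PAGE 1).  Rung (B)+1 of the FINITE-VOLUME T⁴ programme — NOT infinite volume, NOT a mass gap, NOT the Clay problem.  NE9
(`T4OutputRate.NE9` ∧ `FadingMemory`) is a cell NEW ESTIMATE, NOT PRINTED in [I] = [Balaban1987RG1] (CMP **109**) ∕ [II] = [Balaban1988RG2Cluster]
(CMP **116**), NOT PROVED here («NE9 ⇐ the named binders»; spine PROVED 0∕9).  HONEST DEPENDENCY (cell line, verbatim): continuum YM on T⁴ ⇐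
BetaPertH ∧ nine spine estimates (0/9 proved); BetaPertH ⇐ (D1) ∧ (D4) ∧ CAP+tail; G-an2-4 gates asym, D1 and NE2/3/4.

WHAT THIS FILE PROVES (ONE theorem; 0 def, 0 sorry, axioms standard; composition BY NAME).
**`cur_chart_exists_tower_pi_of_unitary_class_topLevel_W80VJDelta`** — (S3) `cur_chart_exists_tower_pi_of_unitary_class_lattice_uniform_W80VJDelta` at `ω = Ω = 1`
read at the constant level maps `n+1` (and any `levB`): `∃ α₁ j₁ ε₄ ε_C R_b R′` BEFORE `∀ (n η c₀ c₁ m U α j₀ levB)` with ONLY print's class hypotheses in the block;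
`∃ h52 hpos′ hposπ` PRODUCED; then (Ψ1)–(Ψ3) for `chartHB 𝔊̃_k 0 (W80 (rieszτ φ) τ U H̃_{1,k} C_k ε_C (Jcur U) (currentCLM φ (n+1) (∇^η_U) (Δ̃_{a,k} − Q_k†∘(aQ_k)))) 0
(A′ ↦ A′ + solA …) ε₄ H̃_{1,k}`.  This is the single-step (top-level) form of the NE9 chain's chart on the cell's MODEL with no displayed letter left.
DISGUISE TEST: composition of two landed theorems; no inequality of the series proved; NOT the two-background chart (the U-dependence ∕ vacuum subtraction is
the located item (J), `HOME/t4/b2b-balaban-t4-ne9-formalise-leaf-01/g98/ROUTE-J-VIA-THM34-g98.md`), NOT claimed that Bałaban's 𝐇_k ∕ old terms meet these letters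
(O-NE9-1; #5 UNRULED); not NE9.
References (TYPES ∕ loci only): [Balaban1985BackgroundPropagators] (3.35)–(3.37) p. 396, (3.119) p. 419, (3.122) p. 420, Thm 3.12 p. 423, Thm 3.13 p. 426;
[Balaban1985Variational] (27)–(28) p. 282, (80) p. 290, (87)–(88) p. 291, Prop. 4 (97)–(98) p. 293, (103) p. 293, (115) p. 294, Prop. 6 (117)–(121) p. 295.
-/

noncomputable section

open Metric Set

namespace Summit.QuantumFields.BalabanUV.T4Continuum.NE9CurChartTowerPiLatticeUniformClassW80VJDeltaTopLevel

open scoped InnerProductSpace ComplexConjugate BigOperators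
open Literature.MathematicalPhysics.QuantumFieldTheory.Balaban1983to89
open B11Eq103H1Complex B11Eq115Space B11Eq174Chart
open B11Eq111FrakG (nabla115)
open B9SectCLatticeCarrier (Bond bpos btgt unshift)
open B4Sect5Torus (TSite)
open B7Prop1Explicit (U1 Wcx boxVec)
open B7Prop2Explicit (pdev AvgClosed C0 c2' unitaryUnits avgClosed_unitaryUnits unitaryUnits_le_U1)
open B7Prop3Flat (c3)
open B9Eq315QTorus (perCfg cornerSite)
open B9Eq315QTower (towerP UlevOf)
open B9Eq326OperatorTower (QkW QkW_surjective laplaceAk)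
open B9Eq310HessianOperator (adTransportW)
open B9Eq310DeltaPrime (plaqHolU)
open B9Eq324DeltaPrimeATower (laplacePrimeAk)
open B9Eq3119DeltaPiTower (laplaceAkPi)
open B11Eq44COperatorTower (αT αT_le ulev_mem_U1_of_pdev)
open B11Eq44COperatorTowerGeometric (ulev_reg_of_pdev_geometric geomProfile_le_αT)
open B11Eq44CLetterTower (Cck)
open Summit.QuantumFields.BalabanUV.T4Continuum.NE9CurChartTowerPiLatticeUniformClassW80VJDelta
  (cur_chart_exists_tower_pi_of_unitary_class_lattice_uniform_W80VJDelta)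
open Summit.QuantumFields.BalabanUV.T4Continuum.NE9CurChartTowerPiLatticeUniformFlatWitness (topLevel_weights zeroExp_weights)
open B9Eq3119DeltaPiCarrier (currentCLM)
open B11Eq98V0primeCurrentSlots (rieszτ)
open B11Eq98CurrentSlot (Jcur)
open B11Eq80Current (W80)

variable {d : ℕ} (hd : 1 ≤ d) (L : ℕ) [NeZero L] (hL : 1 ≤ L) (hL2 : 2 ≤ L) (hL3 : 3 ≤ L) [Fact (0 < (L : ℝ))]
  {𝔸 : Type*} [CStarAlgebra 𝔸] [Nontrivial 𝔸] [FiniteDimensional ℂ 𝔸]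
  {W : Type*} [NormedAddCommGroup W] [InnerProductSpace ℂ W] [FiniteDimensional ℂ W] (φ : W ≃ₗ[ℂ] 𝔸)
  {Mφ Mφ' : ℝ} (hMφ : 0 ≤ Mφ) (hMφ' : 0 ≤ Mφ') (hφ : ∀ w, ‖φ w‖ ≤ Mφ * ‖w‖) (hφ' : ∀ X, ‖φ.symm X‖ ≤ Mφ' * ‖X‖)
  {a : ℝ} (ha : 0 < a) {a' : ℝ} (ha' : 0 < a')
  (τ : 𝔸 →ₗ[ℂ] ℂ) {Cτ : ℝ} (hτ : ∀ X, ‖τ X‖ ≤ Cτ * ‖X‖) (hCτ : 0 ≤ Cτ) {Mτ : ℝ} (hτm : ∀ X Y : 𝔸, ‖τ (X * Y)‖ ≤ Mτ * ‖X‖ * ‖Y‖) (hMτ : 0 ≤ Mτ)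
  {ρw : ℝ} (hρw : 0 ≤ ρw)
  (hτ₁ : ∀ X : 𝔸, τ (star X) = conj (τ X)) (hτ₂ : ∀ X Y : 𝔸, τ (X * Y) = τ (Y * X)) (hφτ : ∀ X Y : 𝔸, ⟪φ.symm X, φ.symm Y⟫_ℂ = τ (star X * Y))
  {α₀ : ℝ} (hα₀ : 0 < α₀) (hα3 : C0 d * α₀ ≤ 1 / 3) (hα4 : 4 * α₀ ≤ c2' d L)
  (hαL : 50 * (d + 1) * αT d L α₀ * (L : ℝ) ^ d ≤ 1 / 2)
  {ρ : ℝ} (hρ0 : 0 < ρ) (hρ : Real.exp (4 * (800 * ((d : ℝ) + 1) ^ 2 * ((d : ℝ) + 4)) * α₀) * (1 + 8 * (131072 * ((d : ℝ) + 1) ^ 2) * ρ) ≤ 2)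
  (hρ4 : 4 * ρ ≤ c3 d L) (hθ : 2 * d * B7Prop5GeneralLevels.thetaGen d L α₀ ≤ (L : ℝ) ^ 3 / 16) (hC3 : 2 * d * B7Prop5GeneralLevels.C3Gen d L * ρ ≤ 1)
  (hCτ1 : Cτ ≤ 1)

-- deep definitional unfolding `laplaceAkPi` ↦ `laplaceALatticeK … (π†Δπ) …` in the statement (as the host)
set_option maxRecDepth 8192 in
set_option maxHeartbeats 3200000 in -- (S3)'s ≈ 60-binder theorem applied once
include hd hL2 hL3 hMφ hMφ' hφ hφ' ha ha' hτ hCτ hτm hMτ hρw hτ₁ hτ₂ hφτ hα₀ hα3 hα4 hαL hρ0 hρ hρ4 hθ hC3 hCτ1 in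
/-- **THE `cur U` CHART FOR EVERY BACKGROUND OF PRINT's CLASS, EVERY LATTICE OF THE TOWER, NOTHING ELSE DISPLAYED** — (S3) at `ω = Ω = 1` and the constant
level maps `n+1` (`topLevel_weights`, `zeroExp_weights`): `∃ α₁ j₁ ε₄ ε_C R_b R′` BEFORE the lattice; per lattice and background `∃ h52 hpos′ hposπ`; then
(Ψ1)–(Ψ3) for the chart with the concrete (L3) current at the concrete `Δ_π`. [folklore]
[cite: Balaban1985BackgroundPropagators, (3.35)–(3.37) p.396, (3.119) p.419, (3.122) p.420, Thm 3.12 p.423, Thm 3.13 p.426; Balaban1985Variational, (27)–(28) p.282, (87)–(88) p.291, Prop. 4 (97)–(98) p.293, (103) p.293, (115) p.294, Prop. 6 (117)–(121) p.295] -/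
theorem cur_chart_exists_tower_pi_of_unitary_class_topLevel_W80VJDelta :
    ∃ α₁ j₁ ε₄ εC Rb R' : ℝ, 0 < α₁ ∧ 0 < j₁ ∧ 0 < Rb ∧ 0 < R' ∧
      ∀ (n : ℕ) (η : ℝ) [Fact (0 < η)] (hηL : η * (L : ℝ) ^ (n + 1) = 1) (c₀ c₁ : ℝ) [Fact (0 < c₀)] [Fact (0 < c₁)]
        (_hw : c₀ * ((L : ℝ) ^ (n + 1)) ^ d = c₁) (_hc₀η : c₀ = η ^ d) (_hρ : |η| ^ d / c₀ ≤ ρw) (m : Fin d → ℕ) [∀ i, NeZero (m i)] (_hm : ∀ i, 1 ≤ m i)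
        (U : Bond d (towerP L m (n + 1)) → 𝔸ˣ) (hUG : ∀ (x : B7Prop1Explicit.Site d) (κ : Fin d), perCfg (towerP L m (n + 1)) U x κ ∈ unitaryUnits 𝔸)
        (α : ℝ) (_hα : 0 ≤ α) (_hαle : α ≤ α₁) (_hUη : ∀ b, ‖(U b : 𝔸) - 1‖ ≤ α * η)
        (_hpl : ∀ p : B9SectCLatticeCarrier.Plaq d (towerP L m (n + 1)), ‖(plaqHolU U p : 𝔸) - 1‖ ≤ α * η ^ 2)
        (_hUgrad : ∀ (x : TSite d (towerP L m (n + 1))) (μ : Fin d), ‖(U (x, μ) : 𝔸) - U (unshift μ x, μ)‖ ≤ α * η ^ 2)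
        (j₀ : ℝ) (_hJ : ∀ μ y, ‖B9Eq39Adjoint.J (fun μ => B9Eq33CovDerivVector.shiftEquiv μ) (fun μ y => U (y, μ)) η μ y‖ ≤ j₀) (_hj : j₀ ≤ j₁)
        (levB : Bond d m → ℕ),
      ∃ h52 : pdev (perCfg (towerP L m (n + 1)) U) < α₀ * (((L : ℝ) ^ (n + 1))⁻¹) ^ 2,
      ∃ hpos' : ∀ x : SiteL2K ℂ d (towerP L m (n + 1)) c₀ W, x ≠ 0 →
          0 < RCLike.re ⟪x, laplacePrimeAk L m n φ η U a' (c₁ := c₁) x⟫_ℂ,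
      ∃ hposπ : ∀ x : BondL2K ℂ d (towerP L m (n + 1)) c₀ W, x ≠ 0 →
          0 < RCLike.re ⟪x, laplaceAkPi L m n φ τ η U a' hpos' hL (fun j => αT d L α₀ * (((L : ℝ) ^ min (j + 1) (n + 1))⁻¹) ^ 2)
            (fun j => (geomProfile_le_αT (d := d) L (n + 1) hL hα₀.le j).trans (αT_le hL hα4))
            (ulev_mem_U1_of_pdev L m (n + 1) U hL2 (avgClosed_unitaryUnits d L) hUG hα₀ hα3 hα4 h52)
            (ulev_reg_of_pdev_geometric L m (n + 1) U hL2 (avgClosed_unitaryUnits d L) hUG hα₀ hα3 hα4 h52) (c₁ := c₁) a x⟫_ℂ,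
        DifferentiableOn ℂ (chartHB (frakGLatticeCLM (lev₀ := fun _ => n + 1) φ hposπ
              (QkW_surjective L m n φ U hL _ _ _ _ fun j => le_trans (mul_le_mul_of_nonneg_right (mul_le_mul_of_nonneg_left
                (geomProfile_le_αT (d := d) L (n + 1) hL hα₀.le j) (by positivity)) (by positivity)) hαL) (fun _ => n + 1) (nabla115 η U))
            0 (W80 (rieszτ φ) (LinearMap.toContinuousLinearMap τ) U (H1LatticeCLM (lev₀ := fun _ => n + 1) (levB := levB) φ hposπ
              (QkW_surjective L m n φ U hL _ _ _ _ fun j => le_trans (mul_le_mul_of_nonneg_right (mul_le_mul_of_nonneg_left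
                (geomProfile_le_αT (d := d) L (n + 1) hL hα₀.le j) (by positivity)) (by positivity)) hαL) (fun _ => n + 1) (nabla115 η U))
              (Cck L m η (n + 1) U (fun _ : Bond d (towerP L m (n + 1)) => n + 1) (fun _ : Bond d (towerP L m (n + 1)) × Fin d => n + 1) (nabla115 η U) levB) εC (Jcur (L := (L : ℝ)) (η := η) (lev₀ := fun _ => n + 1) U)
              (currentCLM φ (fun _ => n + 1) (nabla115 η U)
                (laplaceAkPi L m n φ τ η U a' hpos' hL (fun j => αT d L α₀ * (((L : ℝ) ^ min (j + 1) (n + 1))⁻¹) ^ 2)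
                    (fun j => (geomProfile_le_αT (d := d) L (n + 1) hL hα₀.le j).trans (αT_le hL hα4))
                    (ulev_mem_U1_of_pdev L m (n + 1) U hL2 (avgClosed_unitaryUnits d L) hUG hα₀ hα3 hα4 h52)
                    (ulev_reg_of_pdev_geometric L m (n + 1) U hL2 (avgClosed_unitaryUnits d L) hUG hα₀ hα3 hα4 h52) (c₁ := c₁) a
                  - LinearMap.adjoint (QkW L m n φ U hL (fun j => αT d L α₀ * (((L : ℝ) ^ min (j + 1) (n + 1))⁻¹) ^ 2)
                    (fun j => (geomProfile_le_αT (d := d) L (n + 1) hL hα₀.le j).trans (αT_le hL hα4))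
                    (ulev_mem_U1_of_pdev L m (n + 1) U hL2 (avgClosed_unitaryUnits d L) hUG hα₀ hα3 hα4 h52)
                    (ulev_reg_of_pdev_geometric L m (n + 1) U hL2 (avgClosed_unitaryUnits d L) hUG hα₀ hα3 hα4 h52) (c₀ := c₀) (c₁ := c₁)) ∘ₗ
                      ((a : ℂ) • QkW L m n φ U hL (fun j => αT d L α₀ * (((L : ℝ) ^ min (j + 1) (n + 1))⁻¹) ^ 2)
                    (fun j => (geomProfile_le_αT (d := d) L (n + 1) hL hα₀.le j).trans (αT_le hL hα4))
                    (ulev_mem_U1_of_pdev L m (n + 1) U hL2 (avgClosed_unitaryUnits d L) hUG hα₀ hα3 hα4 h52)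
                    (ulev_reg_of_pdev_geometric L m (n + 1) U hL2 (avgClosed_unitaryUnits d L) hUG hα₀ hα3 hα4 h52) (c₀ := c₀) (c₁ := c₁))))) 0 (fun A' => A' + solA (H1LatticeCLM (lev₀ := fun _ => n + 1) (levB := levB) φ hposπ
              (QkW_surjective L m n φ U hL _ _ _ _ fun j => le_trans (mul_le_mul_of_nonneg_right (mul_le_mul_of_nonneg_left
                (geomProfile_le_αT (d := d) L (n + 1) hL hα₀.le j) (by positivity)) (by positivity)) hαL) (fun _ => n + 1) (nabla115 η U)) 0
              (Cck L m η (n + 1) U (fun _ : Bond d (towerP L m (n + 1)) => n + 1) (fun _ : Bond d (towerP L m (n + 1)) × Fin d => n + 1) (nabla115 η U) levB) 0 εC A') ε₄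
            (H1LatticeCLM (lev₀ := fun _ => n + 1) (levB := levB) φ hposπ
              (QkW_surjective L m n φ U hL _ _ _ _ fun j => le_trans (mul_le_mul_of_nonneg_right (mul_le_mul_of_nonneg_left
                (geomProfile_le_αT (d := d) L (n + 1) hL hα₀.le j) (by positivity)) (by positivity)) hαL) (fun _ => n + 1) (nabla115 η U)))
          (ball (0 : NegSize (L : ℝ) η levB 0 𝔸) Rb) ∧
        MapsTo (chartHB (frakGLatticeCLM (lev₀ := fun _ => n + 1) φ hposπ
              (QkW_surjective L m n φ U hL _ _ _ _ fun j => le_trans (mul_le_mul_of_nonneg_right (mul_le_mul_of_nonneg_left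
                (geomProfile_le_αT (d := d) L (n + 1) hL hα₀.le j) (by positivity)) (by positivity)) hαL) (fun _ => n + 1) (nabla115 η U))
            0 (W80 (rieszτ φ) (LinearMap.toContinuousLinearMap τ) U (H1LatticeCLM (lev₀ := fun _ => n + 1) (levB := levB) φ hposπ
              (QkW_surjective L m n φ U hL _ _ _ _ fun j => le_trans (mul_le_mul_of_nonneg_right (mul_le_mul_of_nonneg_left
                (geomProfile_le_αT (d := d) L (n + 1) hL hα₀.le j) (by positivity)) (by positivity)) hαL) (fun _ => n + 1) (nabla115 η U))
              (Cck L m η (n + 1) U (fun _ : Bond d (towerP L m (n + 1)) => n + 1) (fun _ : Bond d (towerP L m (n + 1)) × Fin d => n + 1) (nabla115 η U) levB) εC (Jcur (L := (L : ℝ)) (η := η) (lev₀ := fun _ => n + 1) U)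
              (currentCLM φ (fun _ => n + 1) (nabla115 η U)
                (laplaceAkPi L m n φ τ η U a' hpos' hL (fun j => αT d L α₀ * (((L : ℝ) ^ min (j + 1) (n + 1))⁻¹) ^ 2)
                    (fun j => (geomProfile_le_αT (d := d) L (n + 1) hL hα₀.le j).trans (αT_le hL hα4))
                    (ulev_mem_U1_of_pdev L m (n + 1) U hL2 (avgClosed_unitaryUnits d L) hUG hα₀ hα3 hα4 h52)
                    (ulev_reg_of_pdev_geometric L m (n + 1) U hL2 (avgClosed_unitaryUnits d L) hUG hα₀ hα3 hα4 h52) (c₁ := c₁) a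
                  - LinearMap.adjoint (QkW L m n φ U hL (fun j => αT d L α₀ * (((L : ℝ) ^ min (j + 1) (n + 1))⁻¹) ^ 2)
                    (fun j => (geomProfile_le_αT (d := d) L (n + 1) hL hα₀.le j).trans (αT_le hL hα4))
                    (ulev_mem_U1_of_pdev L m (n + 1) U hL2 (avgClosed_unitaryUnits d L) hUG hα₀ hα3 hα4 h52)
                    (ulev_reg_of_pdev_geometric L m (n + 1) U hL2 (avgClosed_unitaryUnits d L) hUG hα₀ hα3 hα4 h52) (c₀ := c₀) (c₁ := c₁)) ∘ₗ
                      ((a : ℂ) • QkW L m n φ U hL (fun j => αT d L α₀ * (((L : ℝ) ^ min (j + 1) (n + 1))⁻¹) ^ 2)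
                    (fun j => (geomProfile_le_αT (d := d) L (n + 1) hL hα₀.le j).trans (αT_le hL hα4))
                    (ulev_mem_U1_of_pdev L m (n + 1) U hL2 (avgClosed_unitaryUnits d L) hUG hα₀ hα3 hα4 h52)
                    (ulev_reg_of_pdev_geometric L m (n + 1) U hL2 (avgClosed_unitaryUnits d L) hUG hα₀ hα3 hα4 h52) (c₀ := c₀) (c₁ := c₁))))) 0 (fun A' => A' + solA (H1LatticeCLM (lev₀ := fun _ => n + 1) (levB := levB) φ hposπ
              (QkW_surjective L m n φ U hL _ _ _ _ fun j => le_trans (mul_le_mul_of_nonneg_right (mul_le_mul_of_nonneg_left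
                (geomProfile_le_αT (d := d) L (n + 1) hL hα₀.le j) (by positivity)) (by positivity)) hαL) (fun _ => n + 1) (nabla115 η U)) 0
              (Cck L m η (n + 1) U (fun _ : Bond d (towerP L m (n + 1)) => n + 1) (fun _ : Bond d (towerP L m (n + 1)) × Fin d => n + 1) (nabla115 η U) levB) 0 εC A') ε₄
            (H1LatticeCLM (lev₀ := fun _ => n + 1) (levB := levB) φ hposπ
              (QkW_surjective L m n φ U hL _ _ _ _ fun j => le_trans (mul_le_mul_of_nonneg_right (mul_le_mul_of_nonneg_left
                (geomProfile_le_αT (d := d) L (n + 1) hL hα₀.le j) (by positivity)) (by positivity)) hαL) (fun _ => n + 1) (nabla115 η U)))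
          (ball (0 : NegSize (L : ℝ) η levB 0 𝔸) Rb) (ball (0 : Space115 (L : ℝ) η (fun _ : Bond d (towerP L m (n + 1)) => n + 1) (fun _ : Bond d (towerP L m (n + 1)) × Fin d => n + 1) (nabla115 η U)) R') ∧
        chartHB (frakGLatticeCLM (lev₀ := fun _ => n + 1) φ hposπ
              (QkW_surjective L m n φ U hL _ _ _ _ fun j => le_trans (mul_le_mul_of_nonneg_right (mul_le_mul_of_nonneg_left
                (geomProfile_le_αT (d := d) L (n + 1) hL hα₀.le j) (by positivity)) (by positivity)) hαL) (fun _ => n + 1) (nabla115 η U))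
            0 (W80 (rieszτ φ) (LinearMap.toContinuousLinearMap τ) U (H1LatticeCLM (lev₀ := fun _ => n + 1) (levB := levB) φ hposπ
              (QkW_surjective L m n φ U hL _ _ _ _ fun j => le_trans (mul_le_mul_of_nonneg_right (mul_le_mul_of_nonneg_left
                (geomProfile_le_αT (d := d) L (n + 1) hL hα₀.le j) (by positivity)) (by positivity)) hαL) (fun _ => n + 1) (nabla115 η U))
              (Cck L m η (n + 1) U (fun _ : Bond d (towerP L m (n + 1)) => n + 1) (fun _ : Bond d (towerP L m (n + 1)) × Fin d => n + 1) (nabla115 η U) levB) εC (Jcur (L := (L : ℝ)) (η := η) (lev₀ := fun _ => n + 1) U)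
              (currentCLM φ (fun _ => n + 1) (nabla115 η U)
                (laplaceAkPi L m n φ τ η U a' hpos' hL (fun j => αT d L α₀ * (((L : ℝ) ^ min (j + 1) (n + 1))⁻¹) ^ 2)
                    (fun j => (geomProfile_le_αT (d := d) L (n + 1) hL hα₀.le j).trans (αT_le hL hα4))
                    (ulev_mem_U1_of_pdev L m (n + 1) U hL2 (avgClosed_unitaryUnits d L) hUG hα₀ hα3 hα4 h52)
                    (ulev_reg_of_pdev_geometric L m (n + 1) U hL2 (avgClosed_unitaryUnits d L) hUG hα₀ hα3 hα4 h52) (c₁ := c₁) a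
                  - LinearMap.adjoint (QkW L m n φ U hL (fun j => αT d L α₀ * (((L : ℝ) ^ min (j + 1) (n + 1))⁻¹) ^ 2)
                    (fun j => (geomProfile_le_αT (d := d) L (n + 1) hL hα₀.le j).trans (αT_le hL hα4))
                    (ulev_mem_U1_of_pdev L m (n + 1) U hL2 (avgClosed_unitaryUnits d L) hUG hα₀ hα3 hα4 h52)
                    (ulev_reg_of_pdev_geometric L m (n + 1) U hL2 (avgClosed_unitaryUnits d L) hUG hα₀ hα3 hα4 h52) (c₀ := c₀) (c₁ := c₁)) ∘ₗ
                      ((a : ℂ) • QkW L m n φ U hL (fun j => αT d L α₀ * (((L : ℝ) ^ min (j + 1) (n + 1))⁻¹) ^ 2)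
                    (fun j => (geomProfile_le_αT (d := d) L (n + 1) hL hα₀.le j).trans (αT_le hL hα4))
                    (ulev_mem_U1_of_pdev L m (n + 1) U hL2 (avgClosed_unitaryUnits d L) hUG hα₀ hα3 hα4 h52)
                    (ulev_reg_of_pdev_geometric L m (n + 1) U hL2 (avgClosed_unitaryUnits d L) hUG hα₀ hα3 hα4 h52) (c₀ := c₀) (c₁ := c₁))))) 0 (fun A' => A' + solA (H1LatticeCLM (lev₀ := fun _ => n + 1) (levB := levB) φ hposπ
              (QkW_surjective L m n φ U hL _ _ _ _ fun j => le_trans (mul_le_mul_of_nonneg_right (mul_le_mul_of_nonneg_left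
                (geomProfile_le_αT (d := d) L (n + 1) hL hα₀.le j) (by positivity)) (by positivity)) hαL) (fun _ => n + 1) (nabla115 η U)) 0
              (Cck L m η (n + 1) U (fun _ : Bond d (towerP L m (n + 1)) => n + 1) (fun _ : Bond d (towerP L m (n + 1)) × Fin d => n + 1) (nabla115 η U) levB) 0 εC A') ε₄
            (H1LatticeCLM (lev₀ := fun _ => n + 1) (levB := levB) φ hposπ
              (QkW_surjective L m n φ U hL _ _ _ _ fun j => le_trans (mul_le_mul_of_nonneg_right (mul_le_mul_of_nonneg_left
                (geomProfile_le_αT (d := d) L (n + 1) hL hα₀.le j) (by positivity)) (by positivity)) hαL) (fun _ => n + 1) (nabla115 η U)) 0 = 0 := by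
  obtain ⟨α₁, j₁, ε₄, εC, Rb, R', hα₁, hj₁, hRb0, hR'0, HC⟩ :=
    cur_chart_exists_tower_pi_of_unitary_class_lattice_uniform_W80VJDelta hd L hL hL2 hL3 φ hMφ hMφ' hφ hφ' ha ha' τ hτ hCτ hτm hMτ hρw hτ₁ hτ₂ hφτ hα₀ hα3
      hα4 hαL hρ0 hρ hρ4 hθ hC3 hCτ1 (le_refl (1 : ℝ)) (le_refl (1 : ℝ))
  refine ⟨α₁, j₁, ε₄, εC, Rb, R', hα₁, hj₁, hRb0, hR'0, ?_⟩
  intro n η _ hηL c₀ c₁ _ _ hw hc₀η hρ' m _ hm U hUG α hα0 hαle hUη hpl hUgrad j₀ hJ hj' levB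
  have hw1 := topLevel_weights (ι := Bond d (towerP L m (n + 1))) (L := (L : ℝ)) hηL 1
  have hw2 := topLevel_weights (ι := Bond d (towerP L m (n + 1)) × Fin d) (L := (L : ℝ)) hηL 2
  have hw3 := topLevel_weights (ι := Bond d (towerP L m (n + 1))) (L := (L : ℝ)) hηL 3
  have hwB := zeroExp_weights (L := (L : ℝ)) (η := η) levB
  exact HC n η hηL c₀ c₁ hw hc₀η hρ' m hm U hUG α hα0 hαle hUη hpl hUgrad j₀ hJ hj' (fun _ => n + 1) (fun _ => n + 1) levB (fun _ => le_rfl)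
    hw1.1 hw2.1 hw3.2 hwB hw2.2

end Summit.QuantumFields.BalabanUV.T4Continuum.NE9CurChartTowerPiLatticeUniformClassW80VJDeltaTopLevel

end
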